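import Summits.ResolutionOfSingularities.ResolutionOfSingularities.Theorems.PurelyInseparableDim4IsolationWitness
import Mathlib.RingTheory.PowerSeries.Inverse
import Mathlib.RingTheory.PowerSeries.NoZeroDivisors
import HarnessLib

/-!
# [OURS · res-dim4-pi PR-10, part 3] The CURVE witness for non-isolation (power-series branches), and
  the TRAP-1 specimens T-001 / T-002 (F₃) of the cell are NOT isolated double points

Cell `res-dim4-pi` (D-0157 DOOR 2), brick PR-10 (WORD #24 (a)), third file (seat `res-dim4-p-3`); sequel of
`PurelyInseparableDim4IsolationWitness.lean`.  EN-9 (WORD #25 (c)): the dominant «blind» primes of the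
census are the family `(x_a, x_b x_c + x_b + x_c)` (TRAP-1 / F₃) and the diagonal planes `(x_a, x_b + x_c)`;
the components of `V(J_q⁺(F))` through the origin cut out by the first family are HYPERBOLA branches
`(1 + x_b)(1 + x_c) = 1`, which contain no polynomial line in general (T-001: `V(J₂⁺) = {x₁ = x₃ = 0,
(1 + x₂)(1 + x₄) = 1}` near `0`), so the line witness does not apply; a formal branch
`t ↦ (c₁(t), …, c₄(t)) ∈ K⟦t⟧⁴`, `c(0) = 0`, does.

## What is proved (field `K`; the frame's `singLocusIdeal / originIdeal / IsIsolated / hasseDeriv`)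

* `constantCoeff_aeval_curve`: for a branch `c` with `c(0) = 0`, `(g ∘ c)(0) = g(0)`.
* **`not_isIsolated_of_powerSeriesCurve`**: a branch `c : Fin 4 → K⟦t⟧` with `c(0) = 0`, some `cᵢ ≠ 0`,
  and `D^{(α)}F ∘ c = 0` for `0 < |α| < q` refutes `IsIsolated q F` (kernel of `aeval c` into the domain
  `K⟦t⟧`, via `not_isIsolated_of_ringHom`); `not_isIsolated_two_of_powerSeriesCurve`: at `q = 2` the four
  partials suffice.
* **`not_isIsolated_two_trap1`** (T-001 = TRAP-1's `s₀`, idea-3 / WORD #20 (a)):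
  `F = x₃x₄ + x₂x₃ + x₂x₃x₄ + x₁²x₂ + x₁²x₂³` — `¬ IsIsolated 2 F` over EVERY field, by the branch
  `x₂ = t`, `x₄ = −t(1 + t)⁻¹`, `x₁ = x₃ = 0` (`∂₃F = x₄ + x₂ + x₂x₄` vanishes since `x₄(1 + t) = −t`).
* **`not_isIsolated_two_trapF3`** (T-002 = the desk's reduction `F₃ = x₃x₄ + x₂x₃ + x₂x₃x₄`, WORD #20 (b)):
  `¬ IsIsolated 2 F₃` over every field — here already the `x₁`-AXIS is a line witness (`x₁` is a dummy).

[OURS · counted 0 · elementary; AI kernel work, weaker than expert review.]  `¬ IsIsolated` is a statement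
about the ideal `⟨∂ᵢF⟩`; its reading as «the double-point locus of `z² + F` is not the origin alone» is the
characteristic-`2` one (T-ISO-1).  Nothing here is a statement about resolution of singularities;
resolution in dimension `≥ 4` / characteristic `p > 0` is NOT proved by anything in this file.  Host item
(DR-157-C): `stmt-ResolutionOfSingularities-16155`, helper.
-/

noncomputable section

set_option linter.dupNamespace false -- mandated namespace of this single-conjunct summit

open MvPolynomial Finset
open scoped BigOperators

namespace Summit.ResolutionOfSingularities.ResolutionOfSingularities.Theorems.PIDim4.IsolationCert

/-! ## §1 Power-series branches through the origin -/

/-- Along a branch `c` with `c(0) = 0`, the constant term of `g ∘ c` is `g(0)`. OURS (bookkeeping).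
[cite: AtiyahMacdonald1969, Ch. 1 Ex. 1.1 (the ideal (x₁,…,xₙ))] -/
theorem constantCoeff_aeval_curve {K : Type} [Field K] (c : Fin 4 → PowerSeries K)
    (hc : ∀ k, PowerSeries.constantCoeff (c k) = 0) (g : MvPolynomial (Fin 4) K) :
    PowerSeries.constantCoeff (MvPolynomial.aeval c g) = MvPolynomial.eval (0 : Fin 4 → K) g := by
  have hcomp : (PowerSeries.constantCoeff (R := K)).comp
      (MvPolynomial.aeval c : MvPolynomial (Fin 4) K →ₐ[K] PowerSeries K).toRingHom =
        MvPolynomial.eval (0 : Fin 4 → K) := by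
    refine MvPolynomial.ringHom_ext (fun a => ?_) (fun k => ?_)
    · simp
    · simp [hc k]
  exact congrArg (fun f : MvPolynomial (Fin 4) K →+* K => f g) hcomp

/-- **The CURVE witness.** A formal branch `c : Fin 4 → K⟦t⟧` through the origin (`c(0) = 0`) with some
`cᵢ ≠ 0`, along which every Hasse derivative `D^{(α)}F` (`0 < |α| < q`) vanishes identically, refutes
`IsIsolated q F`: `V(J_q⁺(F))` has a positive-dimensional component through `0` (kernel of `aeval c`, a
prime inside `𝔪₀` other than `𝔪₀`). OURS (elementary). [cite: AtiyahMacdonald1969, Ch. 1 (prime ideals)] -/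
theorem not_isIsolated_of_powerSeriesCurve {K : Type} [Field K] {q : ℕ} {F : MvPolynomial (Fin 4) K}
    (c : Fin 4 → PowerSeries K) (hc : ∀ k, PowerSeries.constantCoeff (c k) = 0) {i : Fin 4}
    (hi : c i ≠ 0)
    (hJ : ∀ α : Fin 4 →₀ ℕ, 0 < α.degree → α.degree < q →
      MvPolynomial.aeval c (hasseDeriv α F) = 0) :
    ¬ IsIsolated q F := by
  refine not_isIsolated_of_ringHom
    (MvPolynomial.aeval c : MvPolynomial (Fin 4) K →ₐ[K] PowerSeries K).toRingHom
    (fun α h0 hq => hJ α h0 hq) (fun g hg => ?_) (i := i) ?_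
  · rw [← constantCoeff_aeval_curve c hc g,
      show MvPolynomial.aeval c g = 0 from hg, map_zero]
  · change MvPolynomial.aeval c (X i : MvPolynomial (Fin 4) K) ≠ 0
    rwa [MvPolynomial.aeval_X]

/-- **`q = 2` curve witness**: the four partials vanish along the branch. OURS (elementary).
[cite: Giraud1975, §1 (Hasse–Schmidt derivations)] -/
theorem not_isIsolated_two_of_powerSeriesCurve {K : Type} [Field K] {F : MvPolynomial (Fin 4) K}
    (c : Fin 4 → PowerSeries K) (hc : ∀ k, PowerSeries.constantCoeff (c k) = 0) {i : Fin 4}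
    (hi : c i ≠ 0) (hJ : ∀ k : Fin 4, MvPolynomial.aeval c (pderiv k F) = 0) :
    ¬ IsIsolated 2 F := by
  refine not_isIsolated_of_powerSeriesCurve c hc hi fun α h0 h2 => ?_
  obtain ⟨k, rfl⟩ := exists_eq_single_of_degree_eq_one (γ := α) (by omega)
  rw [hasseDeriv_single_one]
  exact hJ k

/-! ## §2 Specimens: TRAP-1 (T-001) and its reduction F₃ (T-002) -/

/-- **T-001 (TRAP-1's `s₀`; idea-3, WORD #20 (a)).** `F = x₃x₄ + x₂x₃ + x₂x₃x₄ + x₁²x₂ + x₁²x₂³`: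
`∂F = (2x₁x₂(1 + x₂²), x₃ + x₃x₄ + x₁² + 3x₁²x₂², x₄ + x₂ + x₂x₄, x₃ + x₂x₃)` vanishes along the hyperbola
branch `x₂ = t, x₄ = −t(1+t)⁻¹, x₁ = x₃ = 0` (over ANY field), so `¬ IsIsolated 2 F`: `V(J₂⁺(F))` contains the
regular non-coordinate curve `{x₁ = x₃ = 0, (1 + x₂)(1 + x₄) = 1}` — EN-9's BLIND-REGULAR class.
OURS (‖ K instance of the curve witness; census value). [cite: Giraud1975, §1 (Hasse–Schmidt derivations)] -/
theorem not_isIsolated_two_trap1 {K : Type} [Field K] :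
    ¬ IsIsolated 2 (X 2 * X 3 + X 1 * X 2 + X 1 * X 2 * X 3 + X 0 ^ 2 * X 1 + X 0 ^ 2 * X 1 ^ 3 :
      MvPolynomial (Fin 4) K) := by
  have h1t : PowerSeries.constantCoeff (1 + PowerSeries.X : PowerSeries K) ≠ 0 := by simp
  have hut : (-PowerSeries.X * (1 + PowerSeries.X)⁻¹ : PowerSeries K) * (1 + PowerSeries.X) =
      -PowerSeries.X := by
    rw [mul_assoc, PowerSeries.inv_mul_cancel _ h1t, mul_one]
  refine not_isIsolated_two_of_powerSeriesCurve
    (fun k => if k = 1 then PowerSeries.X else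
      if k = 3 then -PowerSeries.X * (1 + PowerSeries.X)⁻¹ else 0) (fun k => ?_) (i := 1) ?_ (fun k => ?_)
  · fin_cases k <;> simp
  · simp
  · fin_cases k
    all_goals simp [map_add, map_mul, (pderiv _).leibniz_pow, pderiv_X]
    linear_combination hut

/-- **T-002 (the desk's reduction `F₃` of TRAP-1, WORD #20 (b)).** `F₃ = x₃x₄ + x₂x₃ + x₂x₃x₄` (`x₁` dummy):
every partial vanishes on the `x₁`-axis, so `¬ IsIsolated 2 F₃` over any field (line witness).
OURS (‖ K instance; census value). [cite: Giraud1975, §1 (Hasse–Schmidt derivations)] -/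
theorem not_isIsolated_two_trapF3 {K : Type} [Field K] :
    ¬ IsIsolated 2 (X 2 * X 3 + X 1 * X 2 + X 1 * X 2 * X 3 : MvPolynomial (Fin 4) K) := by
  refine not_isIsolated_two_of_line (fun k => if k = 0 then 1 else 0) (i := 0) (by simp) fun k => ?_
  fin_cases k <;> simp [map_add, map_mul, pderiv_X]

end Summit.ResolutionOfSingularities.ResolutionOfSingularities.Theorems.PIDim4.IsolationCert

end
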